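import Literature.AlgebraicGeometry.Modules.TensorStalk
import Literature.AlgebraicGeometry.Modules.PullbackStalk
import Literature.AlgebraicGeometry.Modules.TensorSheafHomAdjunction
import Literature.AlgebraicGeometry.Modules.TensorBraiding
import Literature.AlgebraicGeometry.Modules.InvertibleModule
import Mathlib.RingTheory.Flat.Basic
import HarnessLib

/-!
# `M ⊗ –` is exact when the stalks of `M` are flat (The Stacks Project, Tag 05NE / 08CZ; Hartshorne III Prop. 9.2 context)

Layer `Literature/AlgebraicGeometry/Modules` (0 definitions, 0 named facts, no instances — the preservation facts are theorems,
bind with `haveI` —, no notation). For an `𝒪_X`-module `M` on a scheme `X` all of whose STALKS `M_x` are flat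
`𝒪_{X,x}`-modules (the flatness hypothesis is carried as `∀ x, Module.Flat (𝒪_{X,x}) M_x`, Mathlib's `Module.Flat`; no new
predicate is introduced), the functor `M ⊗ –` (the tree's `(tensorBifunctor X).obj M`, Stacks 01CA) is EXACT:

The Stacks Project, Tag 05NE (Modules, Definition 17.17.1 / Lemma 17.17.2 in the current numbering: "`𝓕` is flat if the functor
`𝓖 ↦ 𝓕 ⊗_{𝒪_X} 𝓖` is exact … `𝓕` is flat if and only if the stalks `𝓕_x` are flat `𝒪_{X,x}`-modules"), the easy direction
"flat stalks ⇒ exact functor": the stalk of `𝟙_M ⊗ ι` at `x` is `𝟙_{M_x} ⊗ ι_x` (`Modules/TensorStalk.stalkTensorEquiv`, natural, Stacks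
01CA Lemma 17.16.1), injective for a monomorphism `ι` by flatness of `M_x` (Mathlib `Module.Flat.lTensor_preserves_injective_linearMap`;
monomorphisms are tested on stalks, `Modules/PullbackStalk`); `M ⊗ –` is a left adjoint (`Modules/TensorSheafHomAdjunction`), hence
right exact; right exact + preserves monomorphisms = exact. By the symmetry of `⊗` (`Modules/TensorBraiding.tensorComm`) the same
holds for `– ⊗ M`.

* `stalkFunctor_map_tensorMap_id_injective_of_flat` — `(𝟙_M ⊗ ι)_x` injective for `ι` mono;
* `preservesMonomorphisms_tensorBifunctor_obj_of_flat`,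
  **`preservesFiniteLimits_tensorBifunctor_obj_of_flat`**, **`preservesHomology_tensorBifunctor_obj_of_flat`** (`M ⊗ –` exact),
  `shortExact_map_tensorBifunctor_obj_of_flat`;
* `tensorBifunctorObjIsoFlipObj` — `M ⊗ – ≅ – ⊗ M`; `preservesFiniteLimits_tensorBifunctor_flip_obj_of_flat`,
  `preservesHomology_tensorBifunctor_flip_obj_of_flat` (`– ⊗ M` exact).

Everything is proved; no named fact. Pattern of proof: the tree's `Modules/BoxTensorExact` (the same argument for
`N ↦ p^*G ⊗ q^*N` on a product over a field). Library only (cell `pub-hodge-ring2`, count-neutral; proves nothing about any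
crux, route or conjecture).

-- TODO(general form): the converse of Tag 05NE ("exact functor ⇒ flat stalks") and flatness as a predicate on `X.Modules`.

## References

* The Stacks Project, Tag 05NE (flat modules on ringed spaces: definition and the stalk criterion), Tag 01CA (Lemma 17.16.1,
  stalks of the tensor product). [StacksProject]
* R. Hartshorne, *Algebraic Geometry*, GTM 52 (1977), III.9 (flat modules, Prop. 9.2 context). [Hartshorne1977]
-/

noncomputable section

-- `TopCat.Presheaf`/`Scheme.Modules` are not reducible (as in Mathlib's `AlgebraicGeometry/Modules`).
set_option backward.isDefEq.respectTransparency false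

open CategoryTheory CategoryTheory.Limits AlgebraicGeometry TopologicalSpace Opposite
open scoped TensorProduct

universe u

namespace Literature.AlgebraicGeometry.Modules

variable {X : Scheme.{u}} (M : X.Modules)

/-! ### §1 `M ⊗ –` preserves monomorphisms when the stalks of `M` are flat -/

/-- **The stalk map of `𝟙_M ⊗ ι` is injective for a monomorphism `ι` when `M_x` is flat**: through
`(M ⊗ N)_x ≅ M_x ⊗ N_x` (natural in `N`) it is `𝟙_{M_x} ⊗ ι_x`, and `ι_x` is injective.
[cite: StacksProject, Tag 05NE] [cite: StacksProject, Tag 01CA (Lemma 17.16.1)] -/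
theorem stalkFunctor_map_tensorMap_id_injective_of_flat (x : X) [Module.Flat (X.presheaf.stalk x) (MStalk x M)]
    {N' N : X.Modules} (ι : N' ⟶ N) [Mono ι] :
    Function.Injective ((stalkFunctor x).map (tensorMap (𝟙 M) ι)) := by
  have hinj : Function.Injective (((stalkFunctor x).map ι).hom.lTensor (MStalk x M)) :=
    Module.Flat.lTensor_preserves_injective_linearMap _ (stalkFunctor_map_injective_of_mono ι x)
  intro v w hvw
  apply (stalkTensorEquiv M N' x).injective
  apply hinj
  change TensorProduct.map LinearMap.id _ _ = TensorProduct.map LinearMap.id _ _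
  rw [← stalkTensorEquiv_naturality_right, ← stalkTensorEquiv_naturality_right]
  exact congrArg _ hvw

/-- **`M ⊗ –` preserves monomorphisms when all stalks of `M` are flat** (monomorphisms are tested on stalks).
[cite: StacksProject, Tag 05NE] -/
theorem preservesMonomorphisms_tensorBifunctor_obj_of_flat (hM : ∀ x : X, Module.Flat (X.presheaf.stalk x) (MStalk x M)) :
    ((tensorBifunctor X).obj M).PreservesMonomorphisms where
  preserves ι _ := mono_of_stalkFunctor_map_injective _ fun x => by
    rw [tensorBifunctor_obj_map]
    exact stalkFunctor_map_tensorMap_id_injective_of_flat M x ι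

/-! ### §2 `M ⊗ –` is exact when the stalks of `M` are flat -/

/-- `M ⊗ –` preserves finite colimits (it is a left adjoint, `M ⊗ – ⊣ 𝓗om(M, –)`); private copy of the tree's
`Modules/BoxTensorExactRight.preservesFiniteColimits_tensorBifunctor_obj` (not imported here). [cite: StacksProject, Tag 01CA] -/
private theorem preservesFiniteColimits_tensorBifunctor_obj' : PreservesFiniteColimits ((tensorBifunctor X).obj M) :=
  haveI := isLeftAdjoint_tensorBifunctor_obj M
  inferInstance

/-- **`M ⊗ –` is left exact when the stalks of `M` are flat**: right exact as a left adjoint, and it preserves monomorphisms.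
[cite: StacksProject, Tag 05NE] -/
theorem preservesFiniteLimits_tensorBifunctor_obj_of_flat (hM : ∀ x : X, Module.Flat (X.presheaf.stalk x) (MStalk x M)) :
    PreservesFiniteLimits ((tensorBifunctor X).obj M) :=
  haveI := preservesFiniteColimits_tensorBifunctor_obj' M
  haveI := additive_tensorBifunctor_obj M
  (Functor.preservesFiniteLimits_iff_forall_exact_map_and_mono _).mpr fun S hS =>
    haveI := hS.mono_f
    ⟨((Functor.preservesFiniteColimits_iff_forall_exact_map_and_epi _).mp inferInstance S hS).1,
      (preservesMonomorphisms_tensorBifunctor_obj_of_flat M hM).preserves S.f⟩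

/-- **`M ⊗ –` is EXACT when the stalks of `M` are flat** (preserves homology: kernels, cokernels, exactness, quasi-isomorphisms
of complexes). [cite: StacksProject, Tag 05NE] -/
theorem preservesHomology_tensorBifunctor_obj_of_flat (hM : ∀ x : X, Module.Flat (X.presheaf.stalk x) (MStalk x M)) :
    haveI := additive_tensorBifunctor_obj M
    ((tensorBifunctor X).obj M).PreservesHomology :=
  haveI := additive_tensorBifunctor_obj M
  haveI := preservesFiniteLimits_tensorBifunctor_obj_of_flat M hM
  haveI := preservesFiniteColimits_tensorBifunctor_obj' M
  inferInstance

/-- **Short exact sequences stay short exact after `M ⊗ –`** when the stalks of `M` are flat.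
[cite: StacksProject, Tag 05NE] -/
theorem shortExact_map_tensorBifunctor_obj_of_flat (hM : ∀ x : X, Module.Flat (X.presheaf.stalk x) (MStalk x M))
    {S : ShortComplex X.Modules} (hS : S.ShortExact) :
    haveI := additive_tensorBifunctor_obj M
    (S.map ((tensorBifunctor X).obj M)).ShortExact :=
  haveI := additive_tensorBifunctor_obj M
  haveI := preservesFiniteLimits_tensorBifunctor_obj_of_flat M hM
  haveI := preservesFiniteColimits_tensorBifunctor_obj' M
  hS.map_of_exact ((tensorBifunctor X).obj M)

/-! ### §3 The symmetric statements for `– ⊗ M` -/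

/-- **`M ⊗ – ≅ – ⊗ M`** as functors, by the symmetry of the tensor product (`tensorComm`, natural). [cite: StacksProject, Tag 01CA] -/
def tensorBifunctorObjIsoFlipObj : (tensorBifunctor X).obj M ≅ (tensorBifunctor X).flip.obj M :=
  NatIso.ofComponents (fun N => tensorComm M N) fun {N N'} g => by
    change tensorMap (𝟙 M) g ≫ (tensorComm M N').hom = (tensorComm M N).hom ≫ tensorMap g (𝟙 M)
    exact tensorMap_tensorComm_hom (𝟙 M) g

/-- `– ⊗ M` is additive. [cite: StacksProject, Tag 01CA] -/
theorem additive_tensorBifunctor_flip_obj : ((tensorBifunctor X).flip.obj M).Additive :=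
  haveI := additive_tensorBifunctor_obj M
  Functor.additive_of_iso (tensorBifunctorObjIsoFlipObj M)

/-- `– ⊗ M` preserves finite colimits. [cite: StacksProject, Tag 01CA] -/
theorem preservesFiniteColimits_tensorBifunctor_flip_obj : PreservesFiniteColimits ((tensorBifunctor X).flip.obj M) :=
  haveI := preservesFiniteColimits_tensorBifunctor_obj' M
  preservesFiniteColimits_of_natIso (tensorBifunctorObjIsoFlipObj M)

/-- **`– ⊗ M` is left exact when the stalks of `M` are flat.** [cite: StacksProject, Tag 05NE] -/
theorem preservesFiniteLimits_tensorBifunctor_flip_obj_of_flat (hM : ∀ x : X, Module.Flat (X.presheaf.stalk x) (MStalk x M)) :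
    PreservesFiniteLimits ((tensorBifunctor X).flip.obj M) :=
  haveI := preservesFiniteLimits_tensorBifunctor_obj_of_flat M hM
  preservesFiniteLimits_of_natIso (tensorBifunctorObjIsoFlipObj M)

/-- **`– ⊗ M` is EXACT when the stalks of `M` are flat.** [cite: StacksProject, Tag 05NE] -/
theorem preservesHomology_tensorBifunctor_flip_obj_of_flat (hM : ∀ x : X, Module.Flat (X.presheaf.stalk x) (MStalk x M)) :
    haveI := additive_tensorBifunctor_flip_obj M
    ((tensorBifunctor X).flip.obj M).PreservesHomology :=
  haveI := additive_tensorBifunctor_flip_obj M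
  haveI := preservesFiniteLimits_tensorBifunctor_flip_obj_of_flat M hM
  haveI := preservesFiniteColimits_tensorBifunctor_flip_obj M
  inferInstance

end Literature.AlgebraicGeometry.Modules

end
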